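import Literature.Computability.Complexity.AverageCaseDepthHierarchy
import Literature.Computability.Complexity.TM2PassThrough
import Literature.Computability.QuantumComplexity.OracleSeparationBQPPH
import HarnessLib

/-!
# The Sipser languages of an oracle (diagonal languages for "`PH^A` is infinite", RST 2015 Thm. 2)

The "classical connection between small-depth computation and the polynomial hierarchy
[FSS81, Sipser 1983]" by which Rossman–Servedio–Tan (FOCS 2015, arXiv:1504.03398
[RossmanServedioTan2015], §2.3, p. 7: "we refer the reader to Chapter 7 of Håstad's thesis … for
the proof of how Theorem 2 follows from Theorem 1") derive their Thm. 2 (`PH` is infinite relative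
to a random oracle; the tree's named fact `rossmanServedioTan2015_thm2`, `RandomOraclePH.lean`)
diagonalizes, at every level, with an oracle language that places a hard depth-`d` function on
the bits of the oracle (Ko 1989, §4.2, p. 15–16: "`L_A = {0ⁿ | (∃y₁, |y₁| = n) ⋯ (Q_k y_k, |y_k| = n)
0ⁿy₁⋯y_k ∈ A}`. Then, clearly, `L_A ∈ Σₖ^P(A)`"). This file fixes these DIAGONAL LANGUAGES for
RST's hard function `Sipser_d` (`balancedSipser`, `AverageCaseDepthHierarchy.lean`) and a UNIFORM
random oracle (every oracle bit is a leaf; compare the block-OR variant `sipserOrLang` of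
`Literature/Barriers/QuantumAdvantage/AaronsonChenPH.lean` for Aaronson–Chen's `𝒟_O`):

* `sipserAddr x i = x ++ natBits |x| i` — the oracle string carrying leaf number `i` of the
  instance at input `x` (all of length `2|x|`, distinct for distinct `(x, i)` with `i < 2^{|x|}`);
* `sipserLang d A` — `x ∈ sipserLang d A` iff the first component of `x` is the binary code of a
  fan-in sequence `ws` of length `d` with `∏ ws ≤ 2^{|x|}`, and the read-once alternating
  depth-`d` formula with fan-ins `ws` (`sipserEval`, root `∨` iff `d` is even, as for `Sipser_d`)
  is true on the oracle bits `[sipserAddr x (addrIndex ws a) ∈ A]`. Reading the fan-ins off the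
  input keeps the deciding machine free of RST's real parameters (`w₀` is defined by a real
  inequality); the lower bound only looks at the inputs `sipserInput m d` carrying RST's own
  fan-ins `rstFanins m d`, on which the language IS `Sipser_d` of the level window
  (`sipserInput_mem_iff`);
* `sipserLang_mem_PHRel` — named fact (the routine half of the connection, Ko: "clearly
  `L_A ∈ Σₖ^P(A)`"): `sipserLang d A ∈ PH^A` for all `d, A` (decode `ws`, reject unless
  `∏ ws ≤ 2^{|x|}`, guess the `d` child indices by `d` alternating polynomially bounded
  quantifiers, make one oracle query); its discharge in the tree's model (`PRel`: transcript
  oracle algorithms with a `TM2`-computable step function) is that machine;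
* the bookkeeping the lower bound (`RandomOraclePHProofs.lean`) needs, all PROVED: locality
  (`sipserLang_congr`), the level window `sipserWindow x ws` (strings of length `2|x|`, in
  bijection with the leaves: `sipserLeafEquiv`), the RST inputs `sipserInput m d` and the length
  of the code of a fan-in sequence (`length_encode_listNat`, `sum_size_le_log_prod`:
  `|code ws| ≤ 4d + 2 + 2(log₂ ∏ ws + d)`, logarithmic in the number of leaves).

## References

* [RossmanServedioTan2015] arXiv:1504.03398, §2.3 (p. 7).
* [Ko1989] K.-I Ko, *Constructing oracles by lower bound techniques for circuits* (1989),
  `lit read doi:10.1007/978-94-009-2411-6_2`, §4.2 (p. 15–16: the languages `L_A`, `L_B`).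
* [FurstSaxeSipser1984], [Sipser1983] (the connection), as cited by RST.
-/

noncomputable section

namespace Literature.Computability.Complexity

open _root_.Computability Literature.Computability.QuantumComplexity Finset

/-! ### Leaf addresses -/

/-- The oracle string carrying leaf number `i` of the instance at input `x`: `x` followed by the
`|x|` low-order bits of `i` (Ko 1989, §4.2: the strings `0ⁿ y₁ ⋯ y_k` of `L_A`). [cite: Ko1989, §4.2 (p. 15)] -/
def sipserAddr (x : List Bool) (i : ℕ) : List Bool := x ++ natBits x.length i

/-- Leaf addresses at input `x` have length `2|x|`. [cite: Ko1989, §4.2 (p. 15)] -/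
@[simp] theorem length_sipserAddr (x : List Bool) (i : ℕ) : (sipserAddr x i).length = 2 * x.length := by
  simp [sipserAddr]; ring

/-- Leaf addresses at `x` are distinct for distinct leaf numbers below `2^{|x|}`. [folklore] -/
theorem sipserAddr_injective {x : List Bool} {i j : ℕ} (hi : i < 2 ^ x.length) (hj : j < 2 ^ x.length)
    (h : sipserAddr x i = sipserAddr x j) : i = j :=
  natBits_injective hi hj (List.append_cancel_left h)

/-! ### The diagonal languages -/

/-- **The Sipser language of depth `d` of the oracle `A`**: `x ∈ sipserLang d A` iff the first
component of `x` is the (binary) code of a fan-in sequence `ws` of length `d` addressing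
`∏ ws ≤ 2^{|x|}` leaves, and the read-once alternating depth-`d` formula with fan-ins `ws` (root
`∨` iff `d` is even, as for RST's `Sipser_d`) evaluates to true on the oracle bits
`[sipserAddr x (addrIndex ws a) ∈ A]` of its leaves `a`. [cite: Ko1989, §4.2 (p. 15–16)] [cite: RossmanServedioTan2015, §2.3 (p. 7)] -/
def sipserLang (d : ℕ) (A : Language Bool) : Language Bool :=
  {x | ∃ ws : List ℕ, ws.length = d ∧ (boolUnpair x).1 = encodingListNatBool.encode ws ∧
    ws.prod ≤ 2 ^ x.length ∧
    sipserEval ws (Nat.bodd d) (fun a => A.boolIndicator (sipserAddr x (addrIndex ws a))) = true}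

/-- Membership of an input `⟨code ws, pad⟩`: the fan-ins are `ws` (the code is injective) and the
condition is the formula on the oracle bits of the leaves. [cite: Ko1989, §4.2 (p. 15–16)] -/
theorem boolPair_mem_sipserLang_iff {d : ℕ} {ws : List ℕ} (hws : ws.length = d) (pad : List Bool)
    (A : Language Bool) :
    boolPair (encodingListNatBool.encode ws) pad ∈ sipserLang d A ↔
      ws.prod ≤ 2 ^ (boolPair (encodingListNatBool.encode ws) pad).length ∧
      sipserEval ws (Nat.bodd d) (fun a => A.boolIndicator
        (sipserAddr (boolPair (encodingListNatBool.encode ws) pad) (addrIndex ws a))) = true := by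
  constructor
  · rintro ⟨ws', -, hcode, hprod, hval⟩
    rw [boolUnpair_boolPair] at hcode
    obtain rfl : ws' = ws := encodingListNatBool.encode_injective hcode.symm
    exact ⟨hprod, hval⟩
  · rintro ⟨hprod, hval⟩
    exact ⟨ws, hws, by rw [boolUnpair_boolPair], hprod, hval⟩

/-- Oracle bits agree when the oracles agree on the string. [folklore] -/
theorem boolIndicator_congr {A A' : Language Bool} {s : List Bool} (h : s ∈ A ↔ s ∈ A') :
    A.boolIndicator s = A'.boolIndicator s := by
  by_cases hs : s ∈ A
  · rw [(Set.mem_iff_boolIndicator _ _).1 hs, (Set.mem_iff_boolIndicator _ _).1 (h.1 hs)]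
  · rw [(Set.notMem_iff_boolIndicator _ _).1 hs,
      (Set.notMem_iff_boolIndicator _ _).1 fun h' => hs (h.2 h')]

/-- **Locality**: membership of `x` in the Sipser language only reads oracle strings of length
`2|x|`. [cite: Ko1989, §4.2 (p. 15–16)] -/
theorem sipserLang_congr {d : ℕ} {A A' : Language Bool} {x : List Bool}
    (h : ∀ s : List Bool, s.length = 2 * x.length → (s ∈ A ↔ s ∈ A')) :
    x ∈ sipserLang d A ↔ x ∈ sipserLang d A' := by
  have hfun : ∀ ws : List ℕ, (fun a : Addr ws => A.boolIndicator (sipserAddr x (addrIndex ws a))) =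
      fun a => A'.boolIndicator (sipserAddr x (addrIndex ws a)) :=
    fun ws => funext fun a => boolIndicator_congr (h _ (length_sipserAddr x _))
  simp only [sipserLang]
  refine exists_congr fun ws => ?_
  rw [hfun ws]

/-- **Named fact (the routine half of the `PH`–`AC⁰` connection): the Sipser languages are in
`PH^A`.** For every `d` and every oracle `A`, `sipserLang d A ∈ PH^A`: decode the fan-ins `ws`
from the first component of the input (reject if it is not the code of a list of length `d`, or if
`∏ ws > 2^{|x|}`), guess the `d` child indices (each below `2^{|x|}`) with `d` alternating
polynomially bounded quantifiers (root `∃` iff `d` is even; out-of-range indices are absorbed with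
the polarity of their quantifier), compute `addrIndex ws a`, and decide the leaf with the single
oracle query `sipserAddr x (addrIndex ws a)` — a `Σ_d^A ∪ Π_d^A ⊆ PH^A` predicate ("Then, clearly,
`L_A ∈ Σₖ^P(A)`", Ko, for the languages `L_A` of the same shape). In the tree's model (`PHRel`
over `PRel`: transcript oracle algorithms with a `TM2`-computable step function) the discharge is
that machine. [cite: Ko1989, §4.2 (p. 15–16)] -/
def sipserLang_mem_PHRel : Prop :=
  ∀ (d : ℕ) (A : Language Bool), sipserLang d A ∈ PHRel (Oracle.ofLanguage A)

/-! ### The level window -/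

/-- The leaf-address map of the instance with fan-ins `ws` at input `x`. [cite: Ko1989, §4.2 (p. 15)] -/
def sipserLeaf (x : List Bool) (ws : List ℕ) (a : Addr ws) : List Bool :=
  sipserAddr x (addrIndex ws a)

/-- When the leaves fit (`∏ ws ≤ 2^{|x|}`), distinct leaves have distinct addresses. [folklore] -/
theorem sipserLeaf_injective {x : List Bool} {ws : List ℕ} (h : ws.prod ≤ 2 ^ x.length) :
    Function.Injective (sipserLeaf x ws) := fun a b hab =>
  addrIndex_injective ws (sipserAddr_injective ((addrIndex_lt ws a).trans_le h)
    ((addrIndex_lt ws b).trans_le h) hab)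

/-- The level window of the instance with fan-ins `ws` at input `x`: the finite set of its leaf
addresses. [cite: Ko1989, §4.2 (p. 15)] -/
def sipserWindow (x : List Bool) (ws : List ℕ) : Finset (List Bool) :=
  univ.image (sipserLeaf x ws)

/-- Every leaf address is in the window. [folklore] -/
theorem sipserLeaf_mem_sipserWindow (x : List Bool) (ws : List ℕ) (a : Addr ws) :
    sipserLeaf x ws a ∈ sipserWindow x ws :=
  mem_image_of_mem _ (mem_univ a)

/-- Window strings have length `2|x|`. [folklore] -/
theorem length_of_mem_sipserWindow {x : List Bool} {ws : List ℕ} {s : List Bool}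
    (hs : s ∈ sipserWindow x ws) : s.length = 2 * x.length := by
  obtain ⟨a, -, rfl⟩ := mem_image.1 hs
  exact length_sipserAddr x _

/-- The window has one string per leaf. [folklore] -/
theorem card_sipserWindow {x : List Bool} {ws : List ℕ} (h : ws.prod ≤ 2 ^ x.length) :
    (sipserWindow x ws).card = ws.prod := by
  rw [sipserWindow, card_image_of_injective _ (sipserLeaf_injective h), card_univ, Addr.card]

/-- **Leaves ≃ window strings** (when the leaves fit). [folklore] -/
def sipserLeafEquiv (x : List Bool) (ws : List ℕ) (h : ws.prod ≤ 2 ^ x.length) :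
    Addr ws ≃ sipserWindow x ws :=
  Equiv.ofBijective (fun a => ⟨sipserLeaf x ws a, sipserLeaf_mem_sipserWindow x ws a⟩)
    ⟨fun a b hab => sipserLeaf_injective h (congrArg Subtype.val hab), fun s => by
      obtain ⟨a, -, ha⟩ := mem_image.1 s.2
      exact ⟨a, Subtype.ext ha⟩⟩

/-- The equivalence sends a leaf to its address. [folklore] -/
@[simp] theorem coe_sipserLeafEquiv (x : List Bool) (ws : List ℕ) (h : ws.prod ≤ 2 ^ x.length)
    (a : Addr ws) : (sipserLeafEquiv x ws h a : List Bool) = sipserLeaf x ws a := rfl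

/-! ### The RST inputs -/

/-- The input carrying RST's fan-ins `rstFanins m d`, padded so that its length is at least `m`
and the `n = rstN m d` leaves fit below `2^{|x|}`. [cite: RossmanServedioTan2015, §6 (p. 15)] -/
def sipserInput (m d : ℕ) : List Bool :=
  boolPair (encodingListNatBool.encode (rstFanins m d))
    (List.replicate (max (rstN m d).size m) false)

/-- The length of an RST input. [folklore] -/
theorem length_sipserInput (m d : ℕ) : (sipserInput m d).length =
    2 * (encodingListNatBool.encode (rstFanins m d)).length + 2 + max (rstN m d).size m := by
  simp [sipserInput]

/-- RST inputs are long: `m ≤ |sipserInput m d|`. [folklore] -/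
theorem le_length_sipserInput (m d : ℕ) : m ≤ (sipserInput m d).length := by
  rw [length_sipserInput]
  exact (le_max_right _ _).trans (Nat.le_add_left _ _)

/-- The leaves of an RST input fit: `rstN m d < 2^{|sipserInput m d|}`. [folklore] -/
theorem rstN_lt_two_pow_length_sipserInput (m d : ℕ) : rstN m d < 2 ^ (sipserInput m d).length := by
  refine (Nat.lt_size_self _).trans_le (Nat.pow_le_pow_right (by norm_num) ?_)
  rw [length_sipserInput]
  exact (le_max_left _ _).trans (Nat.le_add_left _ _)

/-- **On an RST input the Sipser language is `Sipser_d` of the level window**: for `d ≥ 2`,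
`sipserInput m d ∈ sipserLang d A` iff `balancedSipser m d` is true on the oracle bits of the
leaves. [cite: RossmanServedioTan2015, §6 (p. 15)] [cite: Ko1989, §4.2 (p. 15–16)] -/
theorem sipserInput_mem_iff {m d : ℕ} (hd : 2 ≤ d) (A : Language Bool) :
    sipserInput m d ∈ sipserLang d A ↔
      balancedSipser m d (fun a => A.boolIndicator (sipserLeaf (sipserInput m d) (rstFanins m d) a)) = true := by
  rw [sipserInput, boolPair_mem_sipserLang_iff (length_rstFanins hd m), ← sipserInput]
  exact ⟨fun h => h.2, fun h => ⟨(rstN_lt_two_pow_length_sipserInput m d).le, h⟩⟩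

/-! ### The length of the code of a fan-in sequence -/

/-- **The code of a list of naturals has length `4|ws| + 2 + 2 Σ size(wᵢ)`** (unary length, then
the binary codes, all paired with `boolPair`). [folklore] -/
theorem length_encode_listNat (ws : List ℕ) :
    (encodingListNatBool.encode ws).length = 4 * ws.length + 2 + 2 * (ws.map Nat.size).sum := by
  have hunary : ∀ k : ℕ, (unaryEncodeNat k).length = k := fun k => by
    induction k with
    | zero => rfl
    | succ k ih => simp [unaryEncodeNat, ih]
  have hfold : ∀ l : List ℕ, (l.foldr (fun a acc => boolPair (encodingNatBool.encode a) acc) []).length =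
      2 * l.length + 2 * (l.map Nat.size).sum := by
    intro l
    induction l with
    | nil => rfl
    | cons a l ih =>
      simp only [List.foldr_cons, length_boolPair, ih, List.length_cons, List.map_cons, List.sum_cons]
      have : (encodingNatBool.encode a).length = a.size := TM2Pass.length_encodeNat_eq_size a
      rw [this]; ring
  change (boolPair (unaryEncodeNat ws.length) _).length = _
  rw [length_boolPair, hunary, hfold]
  ring

/-- `log₂` is superadditive on positive naturals: `log₂ a + log₂ b ≤ log₂ (a b)`. [folklore] -/
theorem log_two_add_le_log_two_mul {a b : ℕ} (ha : 1 ≤ a) (hb : 1 ≤ b) :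
    Nat.log 2 a + Nat.log 2 b ≤ Nat.log 2 (a * b) := by
  refine Nat.le_log_of_pow_le one_lt_two ?_
  rw [pow_add]
  exact Nat.mul_le_mul (Nat.pow_log_le_self 2 (by omega)) (Nat.pow_log_le_self 2 (by omega))

/-- **The binary lengths of positive naturals sum to at most `log₂` of their product plus their
number.** [folklore] -/
theorem sum_size_le_log_prod : ∀ ws : List ℕ, (∀ w ∈ ws, 1 ≤ w) →
    (ws.map Nat.size).sum ≤ Nat.log 2 ws.prod + ws.length
  | [], _ => by simp
  | w :: ws, h => by
    have hw : 1 ≤ w := h w (by simp)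
    have hws : ∀ v ∈ ws, 1 ≤ v := fun v hv => h v (by simp [hv])
    have ih := sum_size_le_log_prod ws hws
    have hprod : 1 ≤ ws.prod := List.one_le_prod_of_one_le hws
    have hsize : w.size ≤ Nat.log 2 w + 1 := Nat.size_le.2 (Nat.lt_pow_succ_log_self one_lt_two w)
    have hlog := log_two_add_le_log_two_mul hw hprod
    simp only [List.map_cons, List.sum_cons, List.prod_cons, List.length_cons]
    omega

end Literature.Computability.Complexity

end
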